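import Summits.Ventures.PercRepro.SixFourTailLemmas
import Summits.Ventures.PercRepro.SixFourResidueThreeGenericAll

/-!
# PercRepro — C-025 at `(6,4)`: the `g ≥ 101` tail of the per-pair inequality of Theorem G₃ (mine-2 g22, §21.19; re-cut on p3's 3178 — the shared numeric lemmas live in SixFourTailLemmas)

`PerPair3 g p m` (`SixFourResidueThreeGenericAll.lean`) for every `g ≥ 101`, `3 ≤ p ≤ g − 3`, `2 ≤ m < p` —
the interface of the lead's ruling (na)(2a): `∀ g ≥ 101, ∀ p m, 3 ≤ p → p + 3 ≤ g → 2 ≤ m → m < p → PerPair3 g p m`.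
Two regimes in `c = g − p` (§21.16 / §21.19): `c ≥ 11` by the price term alone, `3 ≤ c ≤ 10` by the price term for
`j = p − m ≥ j₀(c)` and by the `δ`-term on the four cells `(c, j) ∈ {(3,1), (3,2), (4,1), (5,1)}`.  Every constant is an
exact rational; the only analytic inputs are four `2^x`-versus-polynomial inductions.
-/

namespace PercRepro.SixFour

/-! ## Step 0: the rearrangement of `L₃` -/

/-- With `c = g − p` and `j = p − m`: `L₃ = (j/(c+j))·[y_P·C(m,2) + bonus₃(m)] + ε(m)·jc/2 + K·δ(m) − (12/5)·C(m,4)`,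
`K = 9/5 + (3/2)c` — the two `ε`-terms of `Lterm3` combine into `ε(m)·jc/2`. -/
theorem Lterm3_eq {g p m : ℕ} (hmp : m ≤ p) (hpg : p ≤ g) (hm : m < g) :
    Lterm3 g p m = ((p - m : ℕ) : ℚ) / (((g - p : ℕ) : ℚ) + ((p - m : ℕ) : ℚ)) * (yP3 g * (m.choose 2 : ℚ) + bonus3 m)
      + (eps m : ℚ) * ((p - m : ℕ) : ℚ) * ((g - p : ℕ) : ℚ) / 2
      + (9 / 5 + 3 / 2 * ((g - p : ℕ) : ℚ)) * (delta m : ℚ) - 12 / 5 * (m.choose 4 : ℚ) := by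
  have e1 : ((g - m : ℕ) : ℚ) = ((g - p : ℕ) : ℚ) + ((p - m : ℕ) : ℚ) := by
    rw [Nat.cast_sub hm.le, Nat.cast_sub hpg, Nat.cast_sub hmp]; ring
  have e2 : ((g : ℚ) - p) = ((g - p : ℕ) : ℚ) := by rw [Nat.cast_sub hpg]
  have c1 : (((g - m).choose 2 : ℕ) : ℚ) = ((g - m : ℕ) : ℚ) * (((g - m : ℕ) : ℚ) - 1) / 2 := Nat.cast_choose_two ℚ (g - m)
  have c2 : (((p - m).choose 2 : ℕ) : ℚ) = ((p - m : ℕ) : ℚ) * (((p - m : ℕ) : ℚ) - 1) / 2 := Nat.cast_choose_two ℚ (p - m)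
  have hD : ((g - p : ℕ) : ℚ) + ((p - m : ℕ) : ℚ) ≠ 0 := by
    have : (0 : ℚ) < ((g - m : ℕ) : ℚ) := by exact_mod_cast (by omega : 0 < g - m)
    rw [← e1]; exact this.ne'
  unfold Lterm3 yPrice3
  rw [c1, c2, e2, e1]
  field_simp
  ring

/-! ## The sufficient condition (S) -/

/-- `K = 9/5 + (3/2)c`. -/
def tailK (c : ℚ) : ℚ := 9 / 5 + 3 / 2 * c

/-- `Q = ε(m)·jc/2 + δ(m)·(K − (3/5)·j/(c+j)) − (12/5)·C(m,4)` — the part of `L₃` below the price term. -/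
def tailQ (c j : ℚ) (m : ℕ) : ℚ :=
  (eps m : ℚ) * j * c / 2 + (delta m : ℚ) * (tailK c - 3 / 5 * (j / (c + j))) - 12 / 5 * (m.choose 4 : ℚ)

/-- `Q ≥ 0` for `c ≥ 3`, `j ≥ 1`. -/
theorem tailQ_nonneg {c j : ℚ} (hc : 3 ≤ c) (hj : 1 ≤ j) (m : ℕ) : 0 ≤ tailQ c j m := by
  unfold tailQ tailK
  have hE : (0 : ℚ) ≤ (eps m : ℚ) := by positivity
  have hD : (0 : ℚ) ≤ (delta m : ℚ) := by positivity
  have hC4 : (m.choose 4 : ℚ) ≤ (delta m : ℚ) := by exact_mod_cast choose_four_le_delta m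
  have ht : j / (c + j) ≤ 1 := by
    rw [div_le_one (by linarith)]; linarith
  have h1 : 0 ≤ (eps m : ℚ) * j * c / 2 := by positivity
  have h2 : (delta m : ℚ) * (3 / 5 * (j / (c + j))) ≤ (delta m : ℚ) * (3 / 5) := by
    apply mul_le_mul_of_nonneg_left _ hD; linarith
  nlinarith [h1, h2, hC4, hD, hc]

/-- **The sufficient condition (S) of §21.19 gives `PerPair3`**: with `c = g − p`, `j = p − m`, `t = j/(c+j)`,
`t·y_P·C(p,2) + Q ≥ K·2^p  ⇒  PerPair3 g p m`. -/
theorem perPair3_of_S {g p m : ℕ} (hmp : m < p) (hpg : p + 3 ≤ g)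
    (hS : tailK ((g - p : ℕ) : ℚ) * 2 ^ p ≤
      ((p - m : ℕ) : ℚ) / (((g - p : ℕ) : ℚ) + ((p - m : ℕ) : ℚ)) * (yP3 g * (p.choose 2 : ℚ))
        + tailQ ((g - p : ℕ) : ℚ) ((p - m : ℕ) : ℚ) m) : PerPair3 g p m := by
  unfold PerPair3
  rw [Lterm3_eq hmp.le (by omega) (by omega)]
  unfold base3
  rw [show ((g : ℚ) - p) = ((g - p : ℕ) : ℚ) by rw [Nat.cast_sub (by omega)]]
  unfold tailQ tailK at hS
  set c : ℚ := ((g - p : ℕ) : ℚ) with hc_def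
  set j : ℚ := ((p - m : ℕ) : ℚ) with hj_def
  set t : ℚ := j / (c + j) with ht_def
  have hc : (3 : ℚ) ≤ c := by rw [hc_def]; exact_mod_cast (by omega : 3 ≤ g - p)
  have hj : (1 : ℚ) ≤ j := by rw [hj_def]; exact_mod_cast (by omega : 1 ≤ p - m)
  have ht0 : 0 ≤ t := by rw [ht_def]; positivity
  have ht1 : t ≤ 1 := by rw [ht_def, div_le_one (by linarith)]; linarith
  have hB := bonus3_eq m
  have hC2 : (0 : ℚ) ≤ (m.choose 2 : ℚ) := by positivity
  have hC2P2 : (m.choose 2 : ℚ) ≤ (p.choose 2 : ℚ) := by exact_mod_cast Nat.choose_le_choose 2 hmp.le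
  have hP2 : (0 : ℚ) ≤ (p.choose 2 : ℚ) := by positivity
  have hDp : (delta p : ℚ) ≤ 2 ^ p := by exact_mod_cast delta_le_two_pow p
  have hC4p : (0 : ℚ) ≤ (p.choose 4 : ℚ) := by positivity
  have hC4D : (m.choose 4 : ℚ) ≤ (delta m : ℚ) := by exact_mod_cast choose_four_le_delta m
  have hC3 : (0 : ℚ) ≤ (m.choose 3 : ℚ) := by positivity
  have hC4 : (0 : ℚ) ≤ (m.choose 4 : ℚ) := by positivity
  have hD : (0 : ℚ) ≤ (delta m : ℚ) := by positivity
  have hE : (0 : ℚ) ≤ (eps m : ℚ) := by positivity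
  have hK : (3 : ℚ) ≤ 9 / 5 + 3 / 2 * c := by linarith
  have hQ : 0 ≤ (eps m : ℚ) * j * c / 2 + (delta m : ℚ) * ((9 / 5 + 3 / 2 * c) - 3 / 5 * t) - 12 / 5 * (m.choose 4 : ℚ) := by
    have := tailQ_nonneg hc hj m
    unfold tailQ tailK at this
    exact this
  -- (1) the left side is at most `C(m,2)·K·2^p`
  have h1 : (m.choose 2 : ℚ) * ((9 / 5 + 3 / 2 * c) * (delta p : ℚ) - 12 / 5 * (p.choose 4 : ℚ)) ≤
      (m.choose 2 : ℚ) * ((9 / 5 + 3 / 2 * c) * 2 ^ p) := by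
    apply mul_le_mul_of_nonneg_left _ hC2
    have := mul_le_mul_of_nonneg_left hDp (by linarith : (0 : ℚ) ≤ 9 / 5 + 3 / 2 * c)
    linarith
  -- (2) `C(m,2)·K·2^p ≤ C(m,2)·(t·y_P·C(p,2) + Q)`
  have h2 : (m.choose 2 : ℚ) * ((9 / 5 + 3 / 2 * c) * 2 ^ p) ≤
      (m.choose 2 : ℚ) * (t * (yP3 g * (p.choose 2 : ℚ)) +
        ((eps m : ℚ) * j * c / 2 + (delta m : ℚ) * ((9 / 5 + 3 / 2 * c) - 3 / 5 * t) - 12 / 5 * (m.choose 4 : ℚ))) :=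
    mul_le_mul_of_nonneg_left hS hC2
  -- (3) `C(m,2)·Q ≤ C(p,2)·Q`
  have h3 : (m.choose 2 : ℚ) * ((eps m : ℚ) * j * c / 2 + (delta m : ℚ) * ((9 / 5 + 3 / 2 * c) - 3 / 5 * t) - 12 / 5 * (m.choose 4 : ℚ)) ≤
      (p.choose 2 : ℚ) * ((eps m : ℚ) * j * c / 2 + (delta m : ℚ) * ((9 / 5 + 3 / 2 * c) - 3 / 5 * t) - 12 / 5 * (m.choose 4 : ℚ)) :=
    mul_le_mul_of_nonneg_right hC2P2 hQ
  -- (4) the bonus term: `t·(B + (3/5)δ) ≥ 0`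
  have h4 : 0 ≤ (p.choose 2 : ℚ) * (t * (bonus3 m + 3 / 5 * (delta m : ℚ))) := by
    apply mul_nonneg hP2; apply mul_nonneg ht0; rw [hB]; linarith
  linarith [h1, h2, h3, h4]

/-! ## Regime II: `c = g − p ≥ 11` — the price term alone -/

/-- (R2) in `ℚ`: `(c+1)(1800 + 1500c)·C(g,2) ≤ 1799·2^c·C(p,2)` for `g ≥ 101`, `3 ≤ p`, `c = g − p ≥ 11`. -/
theorem R2_rat {g p : ℕ} (hg : 101 ≤ g) (hp : 3 ≤ p) (hpg : p + 11 ≤ g) :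
    (((g - p : ℕ) : ℚ) + 1) * (1800 + 1500 * ((g - p : ℕ) : ℚ)) * (g.choose 2 : ℚ) ≤
      1799 * 2 ^ (g - p) * (p.choose 2 : ℚ) := by
  rw [Nat.cast_choose_two ℚ g, Nat.cast_choose_two ℚ p]
  set c : ℕ := g - p with hc_def
  have hcq : ((c : ℕ) : ℚ) = c := rfl
  have hgq : (101 : ℚ) ≤ g := by exact_mod_cast hg
  have hpq : (3 : ℚ) ≤ p := by exact_mod_cast hp
  have hc11 : 11 ≤ c := by omega
  have hcpg : (g : ℚ) = p + c := by rw [hc_def, Nat.cast_sub (by omega)]; ring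
  have h2c : (0 : ℚ) ≤ 2 ^ c := by positivity
  have hgg : (0 : ℚ) ≤ (g : ℚ) * (g - 1) := by nlinarith
  rcases Nat.lt_or_ge g (2 * c) with hlt | hle
  · -- (II-b): `2c > g`, so `g ≤ 2c − 1`, `C(g,2) ≤ c(2c−1)`, `C(p,2) ≥ 3`, and `2^c ≥ 3c⁴`
    have hc22 : 22 ≤ c := by omega
    have hB : (3 : ℚ) * (c : ℚ) ^ 4 ≤ 2 ^ c := by exact_mod_cast two_pow_ge_three_pow_four hc22
    have hg2c : (g : ℚ) ≤ 2 * c - 1 := by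
      have : g + 1 ≤ 2 * c := hlt
      have : ((g + 1 : ℕ) : ℚ) ≤ ((2 * c : ℕ) : ℚ) := by exact_mod_cast this
      push_cast at this; linarith
    have hG : (g : ℚ) * (g - 1) ≤ 2 * c * (2 * c - 1) := by nlinarith
    have hP : (6 : ℚ) ≤ (p : ℚ) * (p - 1) := by nlinarith
    have hcq0 : (1 : ℚ) ≤ c := by exact_mod_cast (by omega : 1 ≤ c)
    have hpoly : ((c : ℚ) + 1) * (1800 + 1500 * c) * (2 * c * (2 * c - 1)) ≤ 26400 * (c : ℚ) ^ 4 := by nlinarith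
    have hL : ((c : ℚ) + 1) * (1800 + 1500 * c) * ((g : ℚ) * (g - 1) / 2) ≤ 13200 * (c : ℚ) ^ 4 := by
      have hpos : (0 : ℚ) ≤ ((c : ℚ) + 1) * (1800 + 1500 * c) := by positivity
      have := mul_le_mul_of_nonneg_left hG hpos
      nlinarith
    have hR : (1799 : ℚ) * 3 * (c : ℚ) ^ 4 * 3 ≤ 1799 * 2 ^ c * ((p : ℚ) * (p - 1) / 2) := by
      have h1 : (1799 : ℚ) * (3 * (c : ℚ) ^ 4) ≤ 1799 * 2 ^ c := mul_le_mul_of_nonneg_left hB (by norm_num)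
      have h2 : (1799 : ℚ) * 2 ^ c * 3 ≤ 1799 * 2 ^ c * ((p : ℚ) * (p - 1) / 2) :=
        mul_le_mul_of_nonneg_left (by linarith) (by positivity)
      nlinarith
    have hc4 : (0 : ℚ) ≤ (c : ℚ) ^ 4 := by positivity
    nlinarith
  · -- (II-a): `2c ≤ g`: `202(p−1) ≥ 99g`, so `40804·C(p,2) ≥ 9801·C(g,2)`, with `regII_a`
    have hA : (((c + 1) * (1800 + 1500 * c) * 40804 : ℕ) : ℚ) ≤ ((17631999 * 2 ^ c : ℕ) : ℚ) := by
      exact_mod_cast regII_a hc11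
    push_cast at hA
    have hρ : (99 : ℚ) * g ≤ 202 * ((p : ℚ) - 1) := by
      have : 99 * g ≤ 202 * (p - 1) := by omega
      have : ((99 * g : ℕ) : ℚ) ≤ ((202 * (p - 1) : ℕ) : ℚ) := by exact_mod_cast this
      push_cast [Nat.cast_sub (by omega : 1 ≤ p)] at this
      linarith
    have hρ' : (9801 : ℚ) * ((g : ℚ) * (g - 1)) ≤ 40804 * ((p : ℚ) * (p - 1)) := by nlinarith
    have h1 := mul_le_mul_of_nonneg_right hA hgg
    have h2 := mul_le_mul_of_nonneg_left hρ' (by positivity : (0 : ℚ) ≤ 1799 * 2 ^ c)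
    nlinarith

/-- **Regime II**: `PerPair3 g p m` for `g ≥ 101`, `3 ≤ p`, `p + 11 ≤ g`, `m < p`. -/
theorem perPair3_regII {g p m : ℕ} (hg : 101 ≤ g) (hp : 3 ≤ p) (hpg : p + 11 ≤ g) (hmp : m < p) : PerPair3 g p m := by
  apply perPair3_of_S hmp (by omega)
  set c : ℚ := ((g - p : ℕ) : ℚ) with hc_def
  set j : ℚ := ((p - m : ℕ) : ℚ) with hj_def
  have hc : (11 : ℚ) ≤ c := by rw [hc_def]; exact_mod_cast (by omega : 11 ≤ g - p)
  have hj : (1 : ℚ) ≤ j := by rw [hj_def]; exact_mod_cast (by omega : 1 ≤ p - m)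
  have hQ := tailQ_nonneg (c := c) (by linarith) hj m
  have hP2 : (0 : ℚ) ≤ (p.choose 2 : ℚ) := by positivity
  have hG2 : (0 : ℚ) < (g.choose 2 : ℚ) := by exact_mod_cast Nat.choose_pos (by omega : 2 ≤ g)
  have hY : (1799 / 1000 : ℚ) * 2 ^ g ≤ F3 g := F3_ge hg
  have hR2 := R2_rat hg hp hpg
  have hpow : (2 : ℚ) ^ g = 2 ^ (g - p) * 2 ^ p := by
    rw [← pow_add]; congr 1; omega
  have h2p : (0 : ℚ) < 2 ^ p := by positivity
  -- `K·(c+1)·2^p ≤ y_P·C(p,2)`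
  have hX : tailK c * (c + 1) * 2 ^ p ≤ yP3 g * (p.choose 2 : ℚ) := by
    unfold yP3
    rw [div_mul_eq_mul_div, le_div_iff₀ hG2]
    have h1 := mul_le_mul_of_nonneg_right hR2 h2p.le
    have h2 := mul_le_mul_of_nonneg_right hY hP2
    rw [hpow] at h2
    unfold tailK
    nlinarith
  have ht : 1 / (c + 1) ≤ j / (c + j) := by
    rw [div_le_div_iff₀ (by linarith) (by linarith)]; nlinarith
  have hYP : 0 ≤ yP3 g * (p.choose 2 : ℚ) := by
    have : (0 : ℚ) ≤ tailK c * (c + 1) * 2 ^ p := by unfold tailK; positivity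
    linarith
  have h5 : 1 / (c + 1) * (tailK c * (c + 1) * 2 ^ p) = tailK c * 2 ^ p := by
    field_simp
  calc tailK c * 2 ^ p = 1 / (c + 1) * (tailK c * (c + 1) * 2 ^ p) := h5.symm
    _ ≤ 1 / (c + 1) * (yP3 g * (p.choose 2 : ℚ)) := mul_le_mul_of_nonneg_left hX (by positivity)
    _ ≤ j / (c + j) * (yP3 g * (p.choose 2 : ℚ)) := mul_le_mul_of_nonneg_right ht hYP
    _ ≤ j / (c + j) * (yP3 g * (p.choose 2 : ℚ)) + tailQ c j m := by linarith

/-! ## Regime I: `3 ≤ c ≤ 10` — the price term for `j ≥ j₀(c)`, the `δ`-term on four cells -/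

/-- A `δ`-term cell: with `t = j/(c+j)` and `2^p = 2^m·2^j`, if the price term gives `A·2^p ≤ y_P·C(p,2)` and the
numeric inequality `K·2^j ≤ t·A·2^j + (927/1000)·[jc/2 + K − (3/5)t − 393/1250]` holds, then (S) holds (`m ≥ 12`). -/
theorem S_of_delta_cell {c j m : ℕ} (hm12 : 12 ≤ m) {A YP : ℚ} (hX : A * (2 ^ m * 2 ^ j) ≤ YP)
    (hbr : 0 ≤ ((j : ℚ) * c / 2 + (9 / 5 + 3 / 2 * c) - 3 / 5 * ((j : ℚ) / (c + j)) - 393 / 1250))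
    (hnum : (9 / 5 + 3 / 2 * (c : ℚ)) * 2 ^ j ≤ (j : ℚ) / (c + j) * A * 2 ^ j +
      927 / 1000 * ((j : ℚ) * c / 2 + (9 / 5 + 3 / 2 * c) - 3 / 5 * ((j : ℚ) / (c + j)) - 393 / 1250)) :
    (9 / 5 + 3 / 2 * (c : ℚ)) * (2 ^ m * 2 ^ j) ≤ (j : ℚ) / (c + j) * YP + tailQ c j m := by
  obtain ⟨hD, hC4, hE⟩ := delta_bounds hm12
  have hDnn : (0 : ℚ) ≤ (delta m : ℚ) := by positivity
  have h2m : (0 : ℚ) ≤ 2 ^ m := by positivity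
  have hjc : (0 : ℚ) ≤ (j : ℚ) * c / 2 := by positivity
  have ht : (0 : ℚ) ≤ (j : ℚ) / (c + j) := by positivity
  -- `Q ≥ δ·[bracket]`
  have hQ1 : (delta m : ℚ) * ((j : ℚ) * c / 2 + (9 / 5 + 3 / 2 * c) - 3 / 5 * ((j : ℚ) / (c + j)) - 393 / 1250) ≤ tailQ c j m := by
    unfold tailQ tailK
    have h1 : (delta m : ℚ) * ((j : ℚ) * c / 2) ≤ (eps m : ℚ) * j * c / 2 := by
      have := mul_le_mul_of_nonneg_right hE hjc; linarith
    nlinarith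
  -- `δ·[bracket] ≥ (927/1000)·2^m·[bracket]`
  have hQ2 : (927 / 1000 : ℚ) * 2 ^ m * ((j : ℚ) * c / 2 + (9 / 5 + 3 / 2 * c) - 3 / 5 * ((j : ℚ) / (c + j)) - 393 / 1250) ≤
      (delta m : ℚ) * ((j : ℚ) * c / 2 + (9 / 5 + 3 / 2 * c) - 3 / 5 * ((j : ℚ) / (c + j)) - 393 / 1250) :=
    mul_le_mul_of_nonneg_right hD hbr
  have hnum' := mul_le_mul_of_nonneg_right hnum h2m
  have hX' : (j : ℚ) / (c + j) * A * 2 ^ j * 2 ^ m ≤ (j : ℚ) / (c + j) * YP := by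
    have := mul_le_mul_of_nonneg_left hX ht
    nlinarith
  nlinarith

/-- **Regime I**: `PerPair3 g p m` for `g ≥ 101`, `p + 3 ≤ g ≤ p + 10`, `2 ≤ m < p`. -/
theorem perPair3_regI {g p m : ℕ} (hg : 101 ≤ g) (hpg : p + 3 ≤ g) (hgp : g ≤ p + 10) (hm : 2 ≤ m) (hmp : m < p) :
    PerPair3 g p m := by
  apply perPair3_of_S hmp hpg
  obtain ⟨c, hc⟩ : ∃ c, c = g - p := ⟨_, rfl⟩
  obtain ⟨j, hj⟩ : ∃ j, j = p - m := ⟨_, rfl⟩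
  rw [← hc, ← hj]
  have hc3 : 3 ≤ c := by omega
  have hc10 : c ≤ 10 := by omega
  have hj1 : 1 ≤ j := by omega
  have hp91 : 91 ≤ p := by omega
  have hcq3 : (3 : ℚ) ≤ c := by exact_mod_cast hc3
  have hjq1 : (1 : ℚ) ≤ j := by exact_mod_cast hj1
  have hQ := tailQ_nonneg (c := c) (j := j) (by linarith) hjq1 m
  have hP2 : (0 : ℚ) ≤ (p.choose 2 : ℚ) := by positivity
  have hG2 : (0 : ℚ) < (g.choose 2 : ℚ) := by exact_mod_cast Nat.choose_pos (by omega : 2 ≤ g)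
  have hY : (1799 / 1000 : ℚ) * 2 ^ g ≤ F3 g := F3_ge hg
  have hρ := rho_regI hg hc hc10 hpg
  have hpow : (2 : ℚ) ^ g = 2 ^ c * 2 ^ p := by rw [← pow_add]; congr 1; omega
  have h2p : (0 : ℚ) < 2 ^ p := by positivity
  have h2c : (0 : ℚ) < 2 ^ c := by positivity
  -- the price term: `A_c·2^p ≤ y_P·C(p,2)` with `A_c = (1799/1000)·((99−c)/100)²·2^c`
  have hX : (1799 / 1000 : ℚ) * (((99 : ℚ) - c) / 100) ^ 2 * 2 ^ c * 2 ^ p ≤ yP3 g * (p.choose 2 : ℚ) := by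
    have e : yP3 g * (p.choose 2 : ℚ) = F3 g * (p.choose 2 : ℚ) / (g.choose 2 : ℚ) := by unfold yP3; ring
    rw [e, le_div_iff₀ hG2]
    have h1 := mul_le_mul_of_nonneg_right hY hP2
    rw [hpow] at h1
    have h2 := mul_le_mul_of_nonneg_left hρ (by positivity : (0 : ℚ) ≤ (1799 / 1000) * 2 ^ c * 2 ^ p)
    have h3 : (0 : ℚ) ≤ (((99 : ℚ) - c) / 100) ^ 2 := by positivity
    nlinarith
  have hYP : 0 ≤ yP3 g * (p.choose 2 : ℚ) := by
    have h3 : (0 : ℚ) ≤ (1799 / 1000 : ℚ) * (((99 : ℚ) - c) / 100) ^ 2 * 2 ^ c * 2 ^ p := by positivity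
    linarith
  have hpm : (2 : ℚ) ^ p = 2 ^ m * 2 ^ j := by rw [← pow_add]; congr 1; omega
  unfold tailK
  interval_cases c
  · -- c = 3: `j ≥ 3` by the price term; `j ∈ {1, 2}` with the `δ`-term
    rcases Nat.lt_or_ge j 3 with hj3 | hj3
    · rw [hpm] at hX ⊢
      interval_cases j <;> exact S_of_delta_cell (by omega) hX (by norm_num) (by norm_num)
    · have hjq : (3 : ℚ) ≤ j := by exact_mod_cast hj3
      exact S_of_yterm (3 : ℚ) (by norm_num) (by norm_num) hjq hX (by norm_num) hQ h2p.le hYP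
  · -- c = 4: `j ≥ 2` by the price term; `j = 1` with the `δ`-term
    rcases Nat.lt_or_ge j 2 with hj2 | hj2
    · rw [hpm] at hX ⊢
      interval_cases j
      exact S_of_delta_cell (by omega) hX (by norm_num) (by norm_num)
    · have hjq : (2 : ℚ) ≤ j := by exact_mod_cast hj2
      exact S_of_yterm (2 : ℚ) (by norm_num) (by norm_num) hjq hX (by norm_num) hQ h2p.le hYP
  · -- c = 5: `j ≥ 2` by the price term; `j = 1` with the `δ`-term
    rcases Nat.lt_or_ge j 2 with hj2 | hj2
    · rw [hpm] at hX ⊢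
      interval_cases j
      exact S_of_delta_cell (by omega) hX (by norm_num) (by norm_num)
    · have hjq : (2 : ℚ) ≤ j := by exact_mod_cast hj2
      exact S_of_yterm (2 : ℚ) (by norm_num) (by norm_num) hjq hX (by norm_num) hQ h2p.le hYP
  all_goals exact S_of_yterm (1 : ℚ) (by norm_num) (by norm_num) hjq1 hX (by norm_num) hQ h2p.le hYP

/-- **The tail** (§21.19): `PerPair3 g p m` for every `g ≥ 101`, `3 ≤ p ≤ g − 3`, `2 ≤ m < p`. -/
theorem perPair3_tail {g p m : ℕ} (hg : 101 ≤ g) (hp : 3 ≤ p) (hpg : p + 3 ≤ g) (hm : 2 ≤ m) (hmp : m < p) :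
    PerPair3 g p m := by
  rcases Nat.lt_or_ge g (p + 11) with h | h
  · exact perPair3_regI hg hpg (by omega) hm hmp
  · exact perPair3_regII hg hp h hmp

/-- **The tail in the interface form** (p2's `PerPairTail`, SixFourResidueThreeGenericGlue — `perPairTail_holds : PerPairTail`
is this theorem verbatim once the Glue lands): `PerPair3 g p m` for every `g ≥ 101`, `3 ≤ p ≤ g − 3`, `2 ≤ m < p`. -/
theorem perPair3_tail_forall : ∀ g, 101 ≤ g → ∀ p m, 3 ≤ p → p + 3 ≤ g → 2 ≤ m → m < p → PerPair3 g p m :=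
  fun _ hg _ _ hp hpg hm hmp => perPair3_tail hg hp hpg hm hmp

end PercRepro.SixFour
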